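import Summits.QuantumFields.YangMills.Theorems.SwapVirialDeficitZeroModeGroupFourSmallBallTwoScale
import Summits.QuantumFields.YangMills.Theorems.SwapVirialDeficitZeroModeGroupConeRadial
import HarnessLib

/-!
# Exact zero-mode rung, FOUR pairwise nearly commuting letters — VII: `Haar⁴(N₄(t))` as an explicit TWO-dimensional integral
# (zero-mode block of crux ⟨stmt-QuantumFields-24497⟩ `ToronTubeVolumeLaw`; free-hands support of ⟨stmt-QuantumFields-24197⟩ / ⟨24497⟩)

Part III (✓`haar_nearlyCommuting_eq_twoScale`) wrote `Haar⁴(N₄(t))/t⁶` as a cone integral of a function of `(a₀, ‖Im a‖²)` alone; the radial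
disintegration ✓`lintegral_coneMeasure_re_normSqIm` (`…ZeroModeGroupConeRadial`) turns it into an integral over `(a₀, ρ) = (re a, ‖Im a‖)`:
★★★ `haar_nearlyCommuting_eq_radial` — for `t > 0`,
`Haar⁴(N₄(t)) = t⁶ · coneConst⁴ · ∫ da₀ · 4π ∫_{ρ>0} ρ² · 𝟙{a₀² + ρ² < 1} · hubFun t a₀ ρ² dρ`,
`hubFun t a₀ σ = ((a₀² + σ)/(16σ))^{3/2} · vol³(T(σ/(a₀²+σ), t²(a₀²+σ)/(4σ), t²(a₀²+σ)²/(4σ²)))` (§24–§25; §24 proves the joint measurability of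
the parameters-to-volume map `(η, ζ, κ) ↦ vol³(T(η, ζ, κ))`).  With `ρ²·ρ⁻³ = 1/ρ` this is LITERALLY `∫ (…) dρ/ρ`: the logarithm of
⟨24497⟩'s two-sided law, now an explicit one-dimensional mechanism (parts V–VI: the last factor tends to `h(t²(a₀²+ρ²)²/(4ρ⁴))`-like profiles with
`h(0⁺) = h(0) ∈ (0, ∞)`, `h(∞) = 0`).
HONEST LABEL: finite-dimensional measure theory on `SU(2)⁴` (plan-level zero-mode rung of DRAFT lines); NOT ⟨24497⟩, NOT ⟨24197⟩; the Yang–Mills mass gap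
is NOT proved; no summit is proved by a line.  Seat ym-line-fcl-p3 g44 (cell ym-idea-1, free hands), `--supports stmt-QuantumFields-24197`.  Standard axioms
(auxiliary defs `paramSet4`, `hubFun`).  References: [cite: GonzalezarroyoAltes1988]; [cite: Vanbaal2001]; [cite: Luscher1983, §2]; [folklore].
-/

set_option autoImplicit false

noncomputable section

open MeasureTheory Quaternion Set
open scoped Quaternion ENNReal BigOperators
open Literature.MathematicalPhysics.QuantumLattice
open Literature.MathematicalPhysics.QuantumFieldTheory (haarProbability)
open Summit.QuantumFields.YangMills.Theorems.SwapTwistDeficit.ToronLog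
open Summit.QuantumFields.YangMills.Theorems.ToronValleyVolume.NearlyCommutingCeiling (sq_norm_im_eq)

attribute [local instance] Literature.Analysis.FluidPDE.Tao2016.quatMeasurableSpace
  Literature.Analysis.FluidPDE.Tao2016.quatBorelSpace
  Literature.MathematicalPhysics.QuantumLattice.secondCountableTopology_su2

namespace Summit.QuantumFields.YangMills.Theorems.SwapVirialDeficit.ZeroModeGroup

/-! ## §24 The parameters-to-volume map is measurable -/

/-- The two-scale family as ONE measurable subset of `(parameters) × (letters)`: `{((η, ζ, κ), w) | w ∈ T(η, ζ, κ)}`. [folklore] -/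
def paramSet4 : Set ((ℝ × ℝ × ℝ) × ((ℍ × ℍ) × ℍ)) := {q | q.2 ∈ twoScaleSet4 q.1.1 q.1.2.1 q.1.2.2}

/-- `paramSet4` is measurable. [folklore] -/
theorem measurableSet_paramSet4 : MeasurableSet paramSet4 := by
  -- coordinates
  have hη : Measurable fun q : (ℝ × ℝ × ℝ) × ((ℍ × ℍ) × ℍ) => q.1.1 := measurable_fst.comp measurable_fst
  have hζ : Measurable fun q : (ℝ × ℝ × ℝ) × ((ℍ × ℍ) × ℍ) => q.1.2.1 := (measurable_fst.comp measurable_snd).comp measurable_fst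
  have hκ : Measurable fun q : (ℝ × ℝ × ℝ) × ((ℍ × ℍ) × ℍ) => q.1.2.2 := (measurable_snd.comp measurable_snd).comp measurable_fst
  have hx : Measurable fun q : (ℝ × ℝ × ℝ) × ((ℍ × ℍ) × ℍ) => q.2.1.1 := (measurable_fst.comp measurable_fst).comp measurable_snd
  have hy : Measurable fun q : (ℝ × ℝ × ℝ) × ((ℍ × ℍ) × ℍ) => q.2.1.2 := (measurable_snd.comp measurable_fst).comp measurable_snd
  have hz : Measurable fun q : (ℝ × ℝ × ℝ) × ((ℍ × ℍ) × ℍ) => q.2.2 := measurable_snd.comp measurable_snd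
  have hc : ∀ {f : (ℝ × ℝ × ℝ) × ((ℍ × ℍ) × ℍ) → ℍ}, Measurable f → ∀ (g : ℍ → ℝ), Continuous g → Measurable fun q => g (f q) :=
    fun hf g hg => hg.measurable.comp hf
  have hR : Continuous fun q : ℍ => q.re := Quaternion.continuous_re
  have hI : Continuous fun q : ℍ => q.imI := Quaternion.continuous_imI
  have hJ : Continuous fun q : ℍ => q.imJ := Quaternion.continuous_imJ
  have hK : Continuous fun q : ℍ => q.imK := Quaternion.continuous_imK
  -- the parametrised norm `tsNorm η ζ (f q)` is measurable in `q`
  have hN : ∀ {f : (ℝ × ℝ × ℝ) × ((ℍ × ℍ) × ℍ) → ℍ}, Measurable f → Measurable fun q => tsNorm q.1.1 q.1.2.1 (f q) := by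
    intro f hf
    unfold tsNorm
    exact (((hc hf _ hR).pow_const 2).add (hη.mul ((hc hf _ hI).pow_const 2))).add
      (hζ.mul (((hc hf _ hJ).pow_const 2).add ((hc hf _ hK).pow_const 2)))
  have hub : ∀ {f : (ℝ × ℝ × ℝ) × ((ℍ × ℍ) × ℍ) → ℍ}, Measurable f →
      MeasurableSet {q : (ℝ × ℝ × ℝ) × ((ℍ × ℍ) × ℍ) | (f q).imJ ^ 2 + (f q).imK ^ 2 ≤ tsNorm q.1.1 q.1.2.1 (f q)} :=
    fun hf => measurableSet_le (((hc hf _ hJ).pow_const 2).add ((hc hf _ hK).pow_const 2)) (hN hf)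
  have cpl : ∀ {f g : (ℝ × ℝ × ℝ) × ((ℍ × ℍ) × ℍ) → ℍ}, Measurable f → Measurable g →
      MeasurableSet {q : (ℝ × ℝ × ℝ) × ((ℍ × ℍ) × ℍ) | ((f q).imK * (g q).imI - (f q).imI * (g q).imK) ^ 2 +
        ((f q).imI * (g q).imJ - (f q).imJ * (g q).imI) ^ 2 + q.1.2.2 * ((f q).imJ * (g q).imK - (f q).imK * (g q).imJ) ^ 2 ≤
          tsNorm q.1.1 q.1.2.1 (f q) * tsNorm q.1.1 q.1.2.1 (g q)} := by
    intro f g hf hg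
    refine measurableSet_le ?_ ((hN hf).mul (hN hg))
    exact ((((hc hf _ hK).mul (hc hg _ hI)).sub ((hc hf _ hI).mul (hc hg _ hK))).pow_const 2 |>.add
      ((((hc hf _ hI).mul (hc hg _ hJ)).sub ((hc hf _ hJ).mul (hc hg _ hI))).pow_const 2)) |>.add
      (hκ.mul ((((hc hf _ hJ).mul (hc hg _ hK)).sub ((hc hf _ hK).mul (hc hg _ hJ))).pow_const 2))
  unfold paramSet4
  simp only [twoScaleSet4, Set.mem_setOf_eq]
  exact (measurableSet_lt (hN hx) measurable_const).inter ((measurableSet_lt (hN hy) measurable_const).inter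
    ((measurableSet_lt (hN hz) measurable_const).inter ((hub hx).inter ((hub hy).inter ((hub hz).inter
      ((cpl hx hy).inter ((cpl hx hz).inter (cpl hy hz))))))))

/-- ★ **`(η, ζ, κ) ↦ vol³(T(η, ζ, κ))` is measurable.** [folklore] -/
theorem measurable_volume_twoScaleSet4 :
    Measurable fun p : ℝ × ℝ × ℝ => (((volume : Measure ℍ).prod (volume : Measure ℍ)).prod (volume : Measure ℍ)) (twoScaleSet4 p.1 p.2.1 p.2.2) := by
  have h := measurable_measure_prodMk_left (ν := (((volume : Measure ℍ).prod (volume : Measure ℍ)).prod (volume : Measure ℍ))) measurableSet_paramSet4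
  exact h

/-! ## §25 The hub function and the radial formula -/

/-- The hub function in the variables `(a₀, σ) = (re a, ‖Im a‖²)`:
`hubFun t a₀ σ = (√(a₀² + σ)/(4√σ))³ · vol³(T(σ/(a₀² + σ), t²(a₀² + σ)/(4σ), t²(a₀² + σ)²/(4σ²)))`. [folklore] -/
def hubFun (t r σ : ℝ) : ℝ≥0∞ :=
  ENNReal.ofReal ((Real.sqrt (r ^ 2 + σ) / (4 * Real.sqrt σ)) ^ 3) *
    (((volume : Measure ℍ).prod (volume : Measure ℍ)).prod (volume : Measure ℍ))
      (twoScaleSet4 (σ / (r ^ 2 + σ)) (t ^ 2 * (r ^ 2 + σ) / (4 * σ)) (t ^ 2 * (r ^ 2 + σ) ^ 2 / (4 * σ ^ 2)))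

/-- `hubFun t` is jointly measurable in `(a₀, σ)`. [folklore] -/
theorem measurable_hubFun (t : ℝ) : Measurable (Function.uncurry (hubFun t)) := by
  have hr : Measurable fun p : ℝ × ℝ => p.1 := measurable_fst
  have hσ : Measurable fun p : ℝ × ℝ => p.2 := measurable_snd
  have hS : Measurable fun p : ℝ × ℝ => p.1 ^ 2 + p.2 := (hr.pow_const 2).add hσ
  have h1 : Measurable fun p : ℝ × ℝ => ENNReal.ofReal ((Real.sqrt (p.1 ^ 2 + p.2) / (4 * Real.sqrt p.2)) ^ 3) :=
    ENNReal.measurable_ofReal.comp (((Real.continuous_sqrt.measurable.comp hS).div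
      ((Real.continuous_sqrt.measurable.comp hσ).const_mul 4)).pow_const 3)
  have hpar : Measurable fun p : ℝ × ℝ => (p.2 / (p.1 ^ 2 + p.2), (t ^ 2 * (p.1 ^ 2 + p.2) / (4 * p.2), t ^ 2 * (p.1 ^ 2 + p.2) ^ 2 / (4 * p.2 ^ 2))) :=
    (hσ.div hS).prodMk (((hS.const_mul _).div (hσ.const_mul 4)).prodMk (((hS.pow_const 2).const_mul _).div ((hσ.pow_const 2).const_mul 4)))
  have h2 := measurable_volume_twoScaleSet4.comp hpar
  have e : Function.uncurry (hubFun t) = fun p : ℝ × ℝ => ENNReal.ofReal ((Real.sqrt (p.1 ^ 2 + p.2) / (4 * Real.sqrt p.2)) ^ 3) *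
      (((volume : Measure ℍ).prod (volume : Measure ℍ)).prod (volume : Measure ℍ))
        (twoScaleSet4 (p.2 / (p.1 ^ 2 + p.2)) (t ^ 2 * (p.1 ^ 2 + p.2) / (4 * p.2)) (t ^ 2 * (p.1 ^ 2 + p.2) ^ 2 / (4 * p.2 ^ 2))) := by
    funext p; rfl
  rw [e]
  exact h1.mul h2

/-- The integrand of part III is `hubFun t (re a) ‖Im a‖²`. [folklore] -/
theorem twoScale_integrand_eq_hubFun (t : ℝ) (a : ℍ) :
    ENNReal.ofReal ((‖a‖ / (4 * ‖a.im‖)) ^ 3) *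
        (((volume : Measure ℍ).prod (volume : Measure ℍ)).prod (volume : Measure ℍ))
          (twoScaleSet4 (‖a.im‖ ^ 2 / ‖a‖ ^ 2) (t ^ 2 * ‖a‖ ^ 2 / (4 * ‖a.im‖ ^ 2)) (t ^ 2 * ‖a‖ ^ 4 / (4 * ‖a.im‖ ^ 4))) =
      hubFun t a.re (‖a.im‖ ^ 2) := by
  have hn2 : ‖a‖ ^ 2 = a.re ^ 2 + ‖a.im‖ ^ 2 := by have := sq_norm_im_eq a; linarith
  have hn : ‖a‖ = Real.sqrt (a.re ^ 2 + ‖a.im‖ ^ 2) := by rw [← hn2, Real.sqrt_sq (norm_nonneg a)]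
  have him : ‖a.im‖ = Real.sqrt (‖a.im‖ ^ 2) := by rw [Real.sqrt_sq (norm_nonneg _)]
  have hn4 : ‖a‖ ^ 4 = (a.re ^ 2 + ‖a.im‖ ^ 2) ^ 2 := by rw [← hn2]; ring
  have hi4 : ‖a.im‖ ^ 4 = (‖a.im‖ ^ 2) ^ 2 := by ring
  unfold hubFun
  rw [← hn, hn2, hn4, hi4, ← him]

/-- ★★★ **`Haar⁴(N₄(t))` AS A TWO-DIMENSIONAL INTEGRAL**: for `t > 0`,
`Haar⁴(N₄(t)) = t⁶ · c³ · (c · ∫ da₀ · 4π ∫_{ρ>0} 𝟙{a₀² + ρ² < 1} · ρ² · hubFun t a₀ ρ² dρ)`, `c = coneConst`; and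
`ρ²·hubFun t a₀ ρ² = (a₀² + ρ²)^{3/2}/64 · vol³(T(ρ²/(a₀²+ρ²), t²(a₀²+ρ²)/(4ρ²), t²(a₀²+ρ²)²/(4ρ⁴))) / ρ` — the `dρ/ρ` of the logarithm. [cite: Luscher1983, §2] -/
theorem haar_nearlyCommuting_eq_radial {t : ℝ} (ht : 0 < t) :
    (Measure.pi fun _ : Fin 4 => haarProbability (Matrix.specialUnitaryGroup (Fin 2) ℂ)) (nearlyCommuting t) =
      ENNReal.ofReal (t ^ 6) * ((ENNReal.ofReal coneConst * ENNReal.ofReal coneConst * ENNReal.ofReal coneConst) *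
        (ENNReal.ofReal coneConst * ∫⁻ r : ℝ, ENNReal.ofReal (4 * Real.pi) *
          ∫⁻ ρ in Ioi (0 : ℝ), {ρ : ℝ | r ^ 2 + ρ ^ 2 < 1}.indicator (fun ρ => ENNReal.ofReal (ρ ^ 2) * hubFun t r (ρ ^ 2)) ρ)) := by
  rw [haar_nearlyCommuting_eq_twoScale ht]
  congr 2
  have e : (fun a : ℍ => ENNReal.ofReal ((‖a‖ / (4 * ‖a.im‖)) ^ 3) *
      (((volume : Measure ℍ).prod (volume : Measure ℍ)).prod (volume : Measure ℍ))
        (twoScaleSet4 (‖a.im‖ ^ 2 / ‖a‖ ^ 2) (t ^ 2 * ‖a‖ ^ 2 / (4 * ‖a.im‖ ^ 2)) (t ^ 2 * ‖a‖ ^ 4 / (4 * ‖a.im‖ ^ 4)))) =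
      fun a => hubFun t a.re (‖a.im‖ ^ 2) := funext (twoScale_integrand_eq_hubFun t)
  rw [e]
  exact lintegral_coneMeasure_re_normSqIm' (hubFun t) (measurable_hubFun t)

/-- The radial integrand made explicit for `ρ > 0`: `hubFun t a₀ ρ² = (√(a₀² + ρ²)/(4ρ))³ · vol³(T(ρ²/(a₀²+ρ²), t²(a₀²+ρ²)/(4ρ²), t²(a₀²+ρ²)²/(4ρ⁴)))`.
[folklore] -/
theorem hubFun_sq {t r ρ : ℝ} (hρ : 0 < ρ) :
    hubFun t r (ρ ^ 2) = ENNReal.ofReal ((Real.sqrt (r ^ 2 + ρ ^ 2) / (4 * ρ)) ^ 3) *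
      (((volume : Measure ℍ).prod (volume : Measure ℍ)).prod (volume : Measure ℍ))
        (twoScaleSet4 (ρ ^ 2 / (r ^ 2 + ρ ^ 2)) (t ^ 2 * (r ^ 2 + ρ ^ 2) / (4 * ρ ^ 2)) (t ^ 2 * (r ^ 2 + ρ ^ 2) ^ 2 / (4 * ρ ^ 4))) := by
  unfold hubFun
  rw [Real.sqrt_sq hρ.le, show (ρ ^ 2) ^ 2 = ρ ^ 4 by ring]

end Summit.QuantumFields.YangMills.Theorems.SwapVirialDeficit.ZeroModeGroup

end
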